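import Mathlib.Algebra.BigOperators.Ring.Finset
import Mathlib.Algebra.BigOperators.Field
import Mathlib.Algebra.Order.BigOperators.Group.Finset
import Mathlib.Algebra.Order.Chebyshev
import Mathlib.Analysis.SpecialFunctions.Pow.Real
import Mathlib.Analysis.SpecialFunctions.Sqrt
import Mathlib.Data.Fintype.BigOperators
import Mathlib.Data.Nat.Bits
import Mathlib.Logic.Equiv.Fin.Basic
import Literature.Computability.Cryptography.FiniteHybrids
import HarnessLib

/-!
# Hashing i.i.d. samples to bits with the inner-product family, against truth-table tests

The Boolean step of Naor–Reingold's Construction 4.2 / Theorem 4.3 (J. ACM 51 (2004), p. 246: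
"`f̃_{k,h}(x) = h(f_k(x))`", `h` from a pairwise independent family; there via the leftover hash
lemma, Lemma 4.2) in the NON-ADAPTIVE, truth-table form needed by the natural-proofs
application: a test `T` reads ALL `N` hashed values at once.

* `innerBit r u = ⟨r, u⟩ mod 2` — the inner-product (Goldreich–Levin) bit of `u ∈ {0,1}^M` with key
  `r ∈ {0,1}^M`; `innerBit_xorVec` (linearity in `u`).
* `sum_innerSign_eq_zero` — `∑_r (-1)^{⟨r,w⟩} = 0` for `w ≠ 0`, and the second-moment identity
  `sum_sq_sum_innerSign` : `∑_r (∑_{v} (-1)^{⟨r, b v⟩})² = |V| · 2^M` for an injective `b : V → {0,1}^M`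
  (Parseval for the family of characters; Arora–Barak 2009, §8.2.2-style pairwise independence).
* `abs_uProb_tables_sub_le` — **i.i.d. biased bits versus uniform bits**: for a fixed
  `h : V → {0,1}` and any test `T` on `N`-bit tables,
  `|Pr_{U ∈ V^N}[T(h ∘ U)] - Pr_{y ∈ {0,1}^N}[T y]| ≤ N · |Pr_v[h v] - 1/2|` (coordinate-wise
  coupling, `abs_uProb_bias_step`).
* `abs_uProb_innerTables_sub_le` — **the hashing lemma**: for `b : V → {0,1}^M` injective with
  `|V| = Q > 0`, `|Pr_{r, U}[T((⟨r, b(U x)⟩)_x)] - Pr_y[T y]| ≤ N / (2 √Q)` (Cauchy–Schwarz over `r`).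

Everything is proved; only finite sums are used.

## References

* M. Naor, O. Reingold, *Number-theoretic constructions of efficient pseudo-random functions*,
  J. ACM 51 (2004), Construction 4.2, Lemma 4.2, Thm. 4.3 (p. 246).
* S. Arora, B. Barak, *Computational Complexity: A Modern Approach*, CUP 2009, §8.2.2
  (pairwise independent hash families), Thm. 9.12 (the inner-product bit).
-/

noncomputable section

namespace Literature.Computability.Cryptography

open Finset Real

variable {M : ℕ}

/-! ### The inner-product bit and its sign character -/

/-- The inner-product bit `⟨r, u⟩ mod 2 = ⊕_l (r_l ∧ u_l)` of two `M`-bit strings (the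
Goldreich–Levin predicate; Arora–Barak 2009, Thm. 9.12). [cite: AroraBarakCC2009, Thm. 9.12] -/
def innerBit (r u : Fin M → Bool) : Bool := (#{l : Fin M | r l && u l}).bodd

/-- The `±1` character `(-1)^{⟨r, u⟩}`. [folklore] -/
def innerSign (r u : Fin M → Bool) : ℝ := if innerBit r u then -1 else 1

/-- Bitwise exclusive or of two strings. [folklore] -/
def xorVec (u v : Fin M → Bool) : Fin M → Bool := fun l => xor (u l) (v l)

/-- The count of an `&&`-event as a sum of indicators. [folklore] -/
theorem card_filter_band_eq_sum (r u : Fin M → Bool) :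
    #{l : Fin M | r l && u l} = ∑ l, (r l && u l).toNat := by
  rw [Finset.card_filter]
  refine Finset.sum_congr rfl fun l _ => ?_
  cases r l <;> cases u l <;> rfl

/-- **Linearity**: `⟨r, u ⊕ v⟩ = ⟨r, u⟩ ⊕ ⟨r, v⟩`. [folklore] -/
theorem innerBit_xorVec (r u v : Fin M → Bool) : innerBit r (xorVec u v) = xor (innerBit r u) (innerBit r v) := by
  unfold innerBit
  rw [card_filter_band_eq_sum, card_filter_band_eq_sum, card_filter_band_eq_sum]
  have key : (∑ l, (r l && xorVec u v l).toNat) + 2 * ∑ l, (r l && u l && v l).toNat =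
      (∑ l, (r l && u l).toNat) + ∑ l, (r l && v l).toNat := by
    rw [Finset.mul_sum, ← Finset.sum_add_distrib, ← Finset.sum_add_distrib]
    refine Finset.sum_congr rfl fun l _ => ?_
    simp only [xorVec]
    cases r l <;> cases u l <;> cases v l <;> rfl
  apply_fun Nat.bodd at key
  rw [Nat.bodd_add, Nat.bodd_mul] at key
  simpa [Nat.bodd_add] using key

/-- Multiplicativity of the character: `χ_r(u) χ_r(v) = χ_r(u ⊕ v)`. [folklore] -/
theorem innerSign_mul (r u v : Fin M → Bool) : innerSign r u * innerSign r v = innerSign r (xorVec u v) := by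
  simp only [innerSign, innerBit_xorVec]
  cases innerBit r u <;> cases innerBit r v <;> simp

/-- `χ_r(0) = 1`. [folklore] -/
theorem innerSign_zero (r : Fin M → Bool) : innerSign r (fun _ => false) = 1 := by
  simp [innerSign, innerBit]

/-- `u ⊕ u = 0`. [folklore] -/
theorem xorVec_self (u : Fin M → Bool) : xorVec u u = fun _ => false := by
  funext l; simp [xorVec]

/-- `u ⊕ v = 0` only if `u = v`. [folklore] -/
theorem eq_of_xorVec_eq_zero {u v : Fin M → Bool} (h : xorVec u v = fun _ => false) : u = v := by
  funext l
  have := congrFun h l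
  simp only [xorVec] at this
  cases hu : u l <;> cases hv : v l <;> simp [hu, hv] at this ⊢

/-- `bodd` of an indicator. [folklore] -/
theorem bodd_toNat_self (b : Bool) : b.toNat.bodd = b := by cases b <;> rfl

/-- A Boolean cancellation: `a ⊕ c = b ⊕ ¬c` forces `a = ¬b`. [folklore] -/
theorem xor_eq_xor_not_cancel (a b c : Bool) (h : xor a c = xor b (!c)) : a = !b := by
  cases a <;> cases b <;> cases c <;> simp at h ⊢

/-- Flipping the key bit `l₀` flips `⟨r, w⟩` when `w_{l₀} = 1`. [folklore] -/
theorem innerBit_update_not (r w : Fin M → Bool) (l₀ : Fin M) (hw : w l₀ = true) :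
    innerBit (Function.update r l₀ (!r l₀)) w = !innerBit r w := by
  unfold innerBit
  rw [card_filter_band_eq_sum, card_filter_band_eq_sum]
  have key : (∑ l, (Function.update r l₀ (!r l₀) l && w l).toNat) + (r l₀).toNat =
      (∑ l, (r l && w l).toNat) + (!r l₀).toNat := by
    rw [← Finset.sum_erase_add _ _ (Finset.mem_univ l₀), ← Finset.sum_erase_add _ _ (Finset.mem_univ l₀)]
    have h1 : ∑ l ∈ univ.erase l₀, (Function.update r l₀ (!r l₀) l && w l).toNat =
        ∑ l ∈ univ.erase l₀, (r l && w l).toNat := by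
      refine Finset.sum_congr rfl fun l hl => ?_
      rw [Function.update_of_ne (Finset.ne_of_mem_erase hl)]
    rw [h1, Function.update_self, hw]
    cases r l₀ <;> simp
  apply_fun Nat.bodd at key
  rw [Nat.bodd_add, Nat.bodd_add, bodd_toNat_self, bodd_toNat_self] at key
  exact xor_eq_xor_not_cancel _ _ _ key

/-- **Orthogonality**: `∑_r (-1)^{⟨r, w⟩} = 0` for `w ≠ 0` (pair `r` with `r ⊕ e_{l₀}` where
`w_{l₀} = 1`). [folklore] -/
theorem sum_innerSign_eq_zero {w : Fin M → Bool} (hw : w ≠ fun _ => false) :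
    ∑ r : Fin M → Bool, innerSign r w = 0 := by
  obtain ⟨l₀, hl₀⟩ : ∃ l₀, w l₀ = true := by
    by_contra h
    push Not at h
    exact hw (funext fun l => by simpa using h l)
  -- the involution `r ↦ r ⊕ e_{l₀}`
  let φ : (Fin M → Bool) ≃ (Fin M → Bool) :=
    { toFun := fun r => Function.update r l₀ (!r l₀)
      invFun := fun r => Function.update r l₀ (!r l₀)
      left_inv := fun r => by
        funext l
        by_cases h : l = l₀
        · subst h; simp
        · simp [Function.update_of_ne h]
      right_inv := fun r => by
        funext l
        by_cases h : l = l₀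
        · subst h; simp
        · simp [Function.update_of_ne h] }
  have hflip : ∀ r, innerSign (φ r) w = -innerSign r w := by
    intro r
    simp only [innerSign, φ, Equiv.coe_fn_mk, innerBit_update_not r w l₀ hl₀]
    cases innerBit r w <;> simp
  have h := Fintype.sum_equiv φ (fun r => innerSign (φ r) w) (fun r => innerSign r w) fun _ => rfl
  simp only [hflip, Finset.sum_neg_distrib] at h
  linarith

/-- `∑_r (-1)^{⟨r, 0⟩} = 2^M`. [folklore] -/
theorem sum_innerSign_zero : ∑ r : Fin M → Bool, innerSign r (fun _ => false) = 2 ^ M := by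
  simp [innerSign_zero]

/-- **Second moment (Parseval)**: for an injective `b : V → {0,1}^M`,
`∑_r (∑_v (-1)^{⟨r, b v⟩})² = |V| · 2^M`. [cite: AroraBarakCC2009, §8.2.2] -/
theorem sum_sq_sum_innerSign {V : Type*} [Fintype V] [DecidableEq V] (b : V → Fin M → Bool)
    (hb : Function.Injective b) :
    ∑ r : Fin M → Bool, (∑ v, innerSign r (b v)) ^ 2 = Fintype.card V * 2 ^ M := by
  calc ∑ r : Fin M → Bool, (∑ v, innerSign r (b v)) ^ 2
      = ∑ r : Fin M → Bool, ∑ v, ∑ w, innerSign r (xorVec (b v) (b w)) := by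
        refine Finset.sum_congr rfl fun r _ => ?_
        rw [sq, Finset.sum_mul_sum]
        refine Finset.sum_congr rfl fun v _ => Finset.sum_congr rfl fun w _ => ?_
        exact innerSign_mul r (b v) (b w)
    _ = ∑ v, ∑ w, ∑ r : Fin M → Bool, innerSign r (xorVec (b v) (b w)) := by
        rw [Finset.sum_comm]
        refine Finset.sum_congr rfl fun v _ => ?_
        rw [Finset.sum_comm]
    _ = ∑ v, ∑ w, (if v = w then (2 : ℝ) ^ M else 0) := by
        refine Finset.sum_congr rfl fun v _ => Finset.sum_congr rfl fun w _ => ?_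
        split_ifs with h
        · subst h; rw [xorVec_self, sum_innerSign_zero]
        · exact sum_innerSign_eq_zero fun h0 => h (hb (eq_of_xorVec_eq_zero h0))
    _ = Fintype.card V * 2 ^ M := by
        simp [Finset.sum_ite_eq, Finset.sum_const, card_univ]

/-! ### The bias of the hashed bit -/

/-- The indicator of the inner-product bit in terms of the character: `[⟨r,u⟩] = (1 - χ_r(u))/2`. [folklore] -/
theorem toNat_innerBit_eq (r u : Fin M → Bool) : ((innerBit r u).toNat : ℝ) = (1 - innerSign r u) / 2 := by
  simp only [innerSign]
  cases innerBit r u <;> norm_num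

/-- The bias of the bit `⟨r, b v⟩` for uniform `v`: `Pr_v[⟨r, b v⟩ = 1] - 1/2 = -(∑_v χ_r(b v)) / (2|V|)`. [folklore] -/
theorem uProb_innerBit_sub_half {V : Type*} [Fintype V] [Nonempty V] (b : V → Fin M → Bool) (r : Fin M → Bool) :
    uProb (fun v => innerBit r (b v)) - 1 / 2 = -(∑ v, innerSign r (b v)) / (2 * (Fintype.card V : ℝ)) := by
  have hV : (0 : ℝ) < Fintype.card V := by exact_mod_cast Fintype.card_pos
  rw [uProb_eq_sum_div]
  simp_rw [toNat_innerBit_eq]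
  rw [← Finset.sum_div, Finset.sum_sub_distrib, Finset.sum_const, card_univ, nsmul_eq_mul, mul_one]
  field_simp
  ring

/-- **Average bias of the inner-product hash on a `Q`-set** (Cauchy–Schwarz on the second
moment): for `b : V → {0,1}^M` injective, `(1/2^M) ∑_r |Pr_v[⟨r, b v⟩] - 1/2| ≤ 1 / (2 √|V|)`.
[cite: NaorReingold2004, Lemma 4.2 (p. 246)] -/
theorem avg_abs_bias_innerBit_le {V : Type*} [Fintype V] [DecidableEq V] [Nonempty V]
    (b : V → Fin M → Bool) (hb : Function.Injective b) :
    (∑ r : Fin M → Bool, |uProb (fun v => innerBit r (b v)) - 1 / 2|) / 2 ^ M ≤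
      1 / (2 * Real.sqrt (Fintype.card V)) := by
  set Q : ℝ := (Fintype.card V : ℝ) with hQ
  have hQpos : 0 < Q := by rw [hQ]; exact_mod_cast Fintype.card_pos
  have hsq : ∑ r : Fin M → Bool, (uProb (fun v => innerBit r (b v)) - 1 / 2) ^ 2 = 2 ^ M / (4 * Q) := by
    simp_rw [uProb_innerBit_sub_half b, neg_div, neg_sq, div_pow]
    rw [← Finset.sum_div, sum_sq_sum_innerSign b hb, ← hQ]
    field_simp
    ring
  -- Cauchy–Schwarz: `(∑ |c_r|)² ≤ 2^M ∑ c_r²`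
  have hcs : (∑ r : Fin M → Bool, |uProb (fun v => innerBit r (b v)) - 1 / 2|) ^ 2 ≤
      (2 : ℝ) ^ M * (2 ^ M / (4 * Q)) := by
    have h := sq_sum_le_card_mul_sum_sq (s := (Finset.univ : Finset (Fin M → Bool)))
      (f := fun r => |uProb (fun v => innerBit r (b v)) - 1 / 2|)
    simp only [card_univ, Fintype.card_fun, Fintype.card_bool, Fintype.card_fin, sq_abs,
      Nat.cast_pow, Nat.cast_ofNat] at h
    rw [hsq] at h
    exact h
  have hS : 0 ≤ ∑ r : Fin M → Bool, |uProb (fun v => innerBit r (b v)) - 1 / 2| :=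
    Finset.sum_nonneg fun _ _ => abs_nonneg _
  have h2M : (0 : ℝ) < 2 ^ M := by positivity
  have hsqrt : 0 < Real.sqrt Q := Real.sqrt_pos.2 hQpos
  rw [div_le_iff₀ h2M]
  -- compare squares
  have htarget : (0 : ℝ) ≤ 1 / (2 * Real.sqrt Q) * 2 ^ M := by positivity
  have hfinal : (∑ r : Fin M → Bool, |uProb (fun v => innerBit r (b v)) - 1 / 2|) ^ 2 ≤
      (1 / (2 * Real.sqrt Q) * 2 ^ M) ^ 2 :=
    calc (∑ r : Fin M → Bool, |uProb (fun v => innerBit r (b v)) - 1 / 2|) ^ 2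
        ≤ (2 : ℝ) ^ M * (2 ^ M / (4 * Q)) := hcs
      _ = (1 / (2 * Real.sqrt Q) * 2 ^ M) ^ 2 := by
          rw [mul_pow, div_pow, mul_pow, Real.sq_sqrt hQpos.le]
          ring
  exact (pow_le_pow_iff_left₀ hS htarget (by norm_num)).1 hfinal

/-! ### I.i.d. biased bits versus uniform bits -/

section Tables

variable {V : Type*} {N : ℕ}

/-- The `i`-th coupling hybrid: positions `< i` carry the hashed samples `h (U x)`, positions
`≥ i` carry fresh uniform bits. [folklore] -/
def tableHybrid (h : V → Bool) (i : ℕ) (ω : (Fin N → V) × (Fin N → Bool)) : Fin N → Bool :=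
  fun x => if x.val < i then h (ω.1 x) else ω.2 x

/-- Hybrid `0` is the uniform table. [folklore] -/
theorem tableHybrid_zero (h : V → Bool) (ω : (Fin N → V) × (Fin N → Bool)) : tableHybrid h 0 ω = ω.2 := by
  funext x; simp [tableHybrid]

/-- Hybrid `N` is the hashed table. [folklore] -/
theorem tableHybrid_N (h : V → Bool) (ω : (Fin N → V) × (Fin N → Bool)) :
    tableHybrid h N ω = fun x => h (ω.1 x) := by
  funext x; simp [tableHybrid, x.isLt]

/-- The table of hybrid `i`/`i+1` with everything but position `i` fixed: positions `< i` from
`U'`, position `i` the given bit, positions `> i` from `y'`. [folklore] -/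
def tableFillAt (h : V → Bool) (i : Fin N) (rest : ({x : Fin N // x ≠ i} → V) × ({x : Fin N // x ≠ i} → Bool))
    (bit : Bool) : Fin N → Bool :=
  fun x => if hx : x = i then bit else if x.val < i.val then h (rest.1 ⟨x, hx⟩) else rest.2 ⟨x, hx⟩

/-- Splitting both coordinate functions at position `i`. [folklore] -/
def tableSplitAt (i : Fin N) : (Fin N → V) × (Fin N → Bool) ≃
    (({x : Fin N // x ≠ i} → V) × ({x : Fin N // x ≠ i} → Bool)) × (V × Bool) :=
  ((Equiv.funSplitAt i V).prodCongr (Equiv.funSplitAt i Bool)).trans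
    { toFun := fun p => ((p.1.2, p.2.2), (p.1.1, p.2.1))
      invFun := fun q => ((q.2.1, q.1.1), (q.2.2, q.1.2))
      left_inv := fun _ => rfl
      right_inv := fun _ => rfl }

/-- Hybrid `i + 1` through the splitting: position `i` carries `h (U i)`. [folklore] -/
theorem tableHybrid_succ_symm (h : V → Bool) (i : Fin N)
    (q : (({x : Fin N // x ≠ i} → V) × ({x : Fin N // x ≠ i} → Bool)) × (V × Bool)) :
    tableHybrid h (i.val + 1) ((tableSplitAt i).symm q) = tableFillAt h i q.1 (h q.2.1) := by
  funext x
  simp only [tableHybrid, tableFillAt, tableSplitAt, Equiv.symm_trans_apply, Equiv.prodCongr_symm,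
    Equiv.coe_fn_symm_mk, Equiv.prodCongr_apply, Prod.map_apply]
  by_cases hx : x = i
  · subst hx
    simp [Equiv.funSplitAt_symm_apply]
  · have hne : x.val ≠ i.val := fun h' => hx (Fin.ext h')
    simp only [Equiv.funSplitAt_symm_apply, dif_neg hx]
    by_cases hlt : x.val < i.val
    · simp [hlt, show x.val < i.val + 1 by omega]
    · simp [hlt, show ¬ (x.val < i.val + 1) by omega]

/-- Hybrid `i` through the splitting: position `i` carries the fresh bit `y i`. [folklore] -/
theorem tableHybrid_symm (h : V → Bool) (i : Fin N)
    (q : (({x : Fin N // x ≠ i} → V) × ({x : Fin N // x ≠ i} → Bool)) × (V × Bool)) :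
    tableHybrid h i.val ((tableSplitAt i).symm q) = tableFillAt h i q.1 q.2.2 := by
  funext x
  simp only [tableHybrid, tableFillAt, tableSplitAt, Equiv.symm_trans_apply, Equiv.prodCongr_symm,
    Equiv.coe_fn_symm_mk, Equiv.prodCongr_apply, Prod.map_apply]
  by_cases hx : x = i
  · subst hx
    simp [Equiv.funSplitAt_symm_apply]
  · simp [Equiv.funSplitAt_symm_apply, dif_neg hx]

/-- **One coupling step**: `|Pr[T(H_{i+1})] - Pr[T(H_i)]| ≤ |Pr_v[h v] - 1/2|`. [folklore] -/
theorem abs_uProb_tableHybrid_step [Fintype V] [Nonempty V] (h : V → Bool) (T : (Fin N → Bool) → Bool) (i : Fin N) :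
    |uProb (fun ω : (Fin N → V) × (Fin N → Bool) => T (tableHybrid h (i.val + 1) ω)) -
      uProb (fun ω : (Fin N → V) × (Fin N → Bool) => T (tableHybrid h i.val ω))| ≤ |uProb h - 1 / 2| := by
  rw [← uProb_comp_equiv (tableSplitAt i).symm (fun ω : (Fin N → V) × (Fin N → Bool) => T (tableHybrid h (i.val + 1) ω)),
    ← uProb_comp_equiv (tableSplitAt i).symm (fun ω : (Fin N → V) × (Fin N → Bool) => T (tableHybrid h i.val ω))]
  simp only [tableHybrid_succ_symm, tableHybrid_symm]
  -- drop the unused coordinate on each side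
  have e1 : uProb (fun q : (({x : Fin N // x ≠ i} → V) × ({x : Fin N // x ≠ i} → Bool)) × (V × Bool) =>
      T (tableFillAt h i q.1 (h q.2.1))) =
      uProb (fun p : (({x : Fin N // x ≠ i} → V) × ({x : Fin N // x ≠ i} → Bool)) × V =>
        T (tableFillAt h i p.1 (h p.2))) := by
    rw [← uProb_comp_equiv (Equiv.prodAssoc _ V Bool)
      (fun q : (({x : Fin N // x ≠ i} → V) × ({x : Fin N // x ≠ i} → Bool)) × (V × Bool) =>
        T (tableFillAt h i q.1 (h q.2.1)))]
    exact uProb_fst (Ω' := Bool) fun p : (({x : Fin N // x ≠ i} → V) × ({x : Fin N // x ≠ i} → Bool)) × V =>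
      T (tableFillAt h i p.1 (h p.2))
  have e2 : uProb (fun q : (({x : Fin N // x ≠ i} → V) × ({x : Fin N // x ≠ i} → Bool)) × (V × Bool) =>
      T (tableFillAt h i q.1 q.2.2)) =
      uProb (fun p : (({x : Fin N // x ≠ i} → V) × ({x : Fin N // x ≠ i} → Bool)) × Bool =>
        T (tableFillAt h i p.1 p.2)) := by
    rw [← uProb_comp_equiv ((Equiv.prodAssoc _ Bool V).trans
        (Equiv.prodCongr (Equiv.refl _) (Equiv.prodComm Bool V)))
      (fun q : (({x : Fin N // x ≠ i} → V) × ({x : Fin N // x ≠ i} → Bool)) × (V × Bool) =>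
        T (tableFillAt h i q.1 q.2.2))]
    exact uProb_fst (Ω' := V) fun p : (({x : Fin N // x ≠ i} → V) × ({x : Fin N // x ≠ i} → Bool)) × Bool =>
      T (tableFillAt h i p.1 p.2)
  rw [e1, e2]
  exact abs_uProb_bias_step h fun rest bit => T (tableFillAt h i rest bit)

/-- **I.i.d. biased bits versus uniform bits**: a test on `N`-bit tables tells the table of
hashed i.i.d. uniform samples `(h (U x))_x` from a uniform table with advantage at most
`N · |Pr_v[h v] - 1/2|`. [folklore] -/
theorem abs_uProb_tables_sub_le [Fintype V] [Nonempty V] (h : V → Bool) (T : (Fin N → Bool) → Bool) :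
    |uProb (fun U : Fin N → V => T fun x => h (U x)) - uProb (fun y : Fin N → Bool => T y)| ≤
      N * |uProb h - 1 / 2| := by
  have hN : uProb (fun U : Fin N → V => T fun x => h (U x)) =
      uProb (fun ω : (Fin N → V) × (Fin N → Bool) => T (tableHybrid h N ω)) := by
    simp only [tableHybrid_N]
    exact (uProb_fst (Ω' := Fin N → Bool) fun U : Fin N → V => T fun x => h (U x)).symm
  have h0 : uProb (fun y : Fin N → Bool => T y) =
      uProb (fun ω : (Fin N → V) × (Fin N → Bool) => T (tableHybrid h 0 ω)) := by
    simp only [tableHybrid_zero]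
    exact (uProb_snd (Ω := Fin N → V) fun y : Fin N → Bool => T y).symm
  rw [hN, h0, abs_sub_comm]
  refine abs_uProb_sub_le_mul (fun i ω => T (tableHybrid h i ω)) N fun i hi => ?_
  rw [abs_sub_comm]
  exact abs_uProb_tableHybrid_step h T ⟨i, hi⟩

end Tables

/-! ### The hashing lemma -/

/-- **Hashing a pseudo-random function to one bit (truth-table form of Naor–Reingold's
Thm. 4.3 step)**: if the `N` values are i.i.d. uniform on a set of `Q = |V|` distinct `M`-bit
strings (`b` injective) and are hashed with a uniform inner-product key `r`, the resulting
`N`-bit table is told from a uniform table by any test with advantage at most `N / (2√Q)`.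
[cite: NaorReingold2004, Construction 4.2 and Thm. 4.3 (p. 246)] -/
theorem abs_uProb_innerTables_sub_le {V : Type*} [Fintype V] [DecidableEq V] [Nonempty V] {N : ℕ}
    (b : V → Fin M → Bool) (hb : Function.Injective b) (T : (Fin N → Bool) → Bool) :
    |uProb (fun ω : (Fin M → Bool) × (Fin N → V) => T fun x => innerBit ω.1 (b (ω.2 x))) -
      uProb (fun y : Fin N → Bool => T y)| ≤ N / (2 * Real.sqrt (Fintype.card V)) := by
  have h2M : (0 : ℝ) < 2 ^ M := by positivity
  -- average over the key `r`
  have havg : uProb (fun ω : (Fin M → Bool) × (Fin N → V) => T fun x => innerBit ω.1 (b (ω.2 x))) -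
      uProb (fun y : Fin N → Bool => T y) =
      (∑ r : Fin M → Bool, (uProb (fun U : Fin N → V => T fun x => innerBit r (b (U x))) -
        uProb (fun y : Fin N → Bool => T y))) / 2 ^ M := by
    rw [uProb_prod_eq_avg, Finset.sum_sub_distrib, Finset.sum_const, card_univ, sub_div]
    simp [Fintype.card_bool, Fintype.card_fin, nsmul_eq_mul]
  rw [havg, abs_div, abs_of_pos h2M, div_le_iff₀ h2M]
  calc |∑ r : Fin M → Bool, (uProb (fun U : Fin N → V => T fun x => innerBit r (b (U x))) -
          uProb (fun y : Fin N → Bool => T y))|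
      ≤ ∑ r : Fin M → Bool, |uProb (fun U : Fin N → V => T fun x => innerBit r (b (U x))) -
          uProb (fun y : Fin N → Bool => T y)| := abs_sum_le_sum_abs _ _
    _ ≤ ∑ r : Fin M → Bool, N * |uProb (fun v => innerBit r (b v)) - 1 / 2| :=
        Finset.sum_le_sum fun r _ => abs_uProb_tables_sub_le (fun v => innerBit r (b v)) T
    _ = N * ∑ r : Fin M → Bool, |uProb (fun v => innerBit r (b v)) - 1 / 2| := by rw [Finset.mul_sum]
    _ ≤ N * (1 / (2 * Real.sqrt (Fintype.card V)) * 2 ^ M) := by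
        refine mul_le_mul_of_nonneg_left ?_ (Nat.cast_nonneg _)
        have := avg_abs_bias_innerBit_le b hb
        rwa [div_le_iff₀ h2M] at this
    _ = N / (2 * Real.sqrt (Fintype.card V)) * 2 ^ M := by ring

end Literature.Computability.Cryptography

end
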